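import Summits.SmoothPoincare4.SmoothPoincare4.Theorems.CylinderEntropyCylinderRungTwoKillingFluxDefs
import Literature.Geometry.Riemannian.MaximumPrincipleAtMaxima
import Literature.Geometry.Riemannian.EuclideanHypersurfaceContact
import Literature.Geometry.Riemannian.MCFComparisonPrinciple
import HarnessLib

/-!
# Slab confinement of a mean curvature flow of cross-sections of `S⁴ × ℝ`
# (stub `stub_slabConfinement`)

Stub `stub_slabConfinement` (3b-ii) of line `killing-flux` for the crux `CylinderEntropy.CylinderRungTwo`
(stmt-SmoothPoincare4-7631), registered signature, proved without named facts.

## Statement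

Let `N = {z ∈ ℝ⁶ | ∑_{i<5} zᵢ² = 1} = S⁴ × ℝ` and let `(F, ν)` be a smooth mean curvature flow of closed
embedded cross-sections of `N` on `[T, ∞)` in the sense of `IsCylinderMCF` (vocabulary file
`…KillingFluxDefs.lean`: `F t : M → ℝ⁶` embeddings into `N`, `ν t` a unit normal of `Σ_t = F t (M)`
tangent to `N`, `∂ₜF = -H ν` with `H` the tree's `meanCurvature`). Then the height `z₅ ∘ F t` stays in
the initial slab: for `t ≥ T` and `x : M` there are `y, y' : M` with
`(F T y)₅ ≤ (F t x)₅ ≤ (F T y')₅` — the maximal height is non-increasing and the minimal height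
non-decreasing (avoidance with the static minimal slices `S⁴ × {c}`).

## Proof

The maximum principle in its maximum-point form (tree
`Literature.Geometry.Riemannian.le_zero_of_deriv_le_mul_at_isMaxOn`, Topping 2006, Thm. 3.1.1) applied on
the compact `M` to `u(s, x) = ε (F (T + s) x)₅ - max_y ε (F T y)₅`, `ε = ±1`, with `C = 0`: only the
sign of the time derivative `∂ₜ (F t x)₅ = -H ν₅` at a SPATIAL MAXIMUM `x` of `ε z₅ ∘ F t` is needed,
and there `ε (-H ν₅) ≤ 0` (`mul_neg_meanCurvature_mul_nonpos`):

1. *first order* — `x` is a critical point of the height, `⟪e₅, dF_x u⟫ = 0` (Fermat along the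
   chart-straight curves `curveThrough`), and the radial normal `n = (z', 0)` of `N` at `F x = (z', z₅)`
   is normal to `Σ_t` (differentiate `∑_{i<5} Fᵢ² = 1`); `dF_x` is injective of rank `4`, so
   `(v, c) ↦ dF_x v + c n` is an injective map of rank `5` into `ℝ⁶` whose image is orthogonal to the
   unit vector `ν` (`ν ⊥ dF`, `ν ⊥ n`) and to `e₅` (`e₅ ⊥ dF`, `e₅ ⊥ n`), whence `e₅ = ν₅ ν`
   (`EuclideanHypersurface.eq_inner_smul_of_forall_inner_eq_zero`; `axis_eq_smul`);
2. *second order* — by the tree's trace formula `H = -⟪ν, ∑ᵢ βᵢ''(0)⟫`, `βᵢ = F t ∘ curveThrough x bᵢ`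
   over an `F_t^*δ`-orthonormal frame `bᵢ` (`EuclideanHypersurface.meanCurvature_eq_neg_inner_sum`,
   Mantegazza 2011, §1.1), `-H ν₅ = ⟪ν₅ ν, ∑ᵢ βᵢ''(0)⟫ = ∑ᵢ (βᵢ''(0))₅`, and each `ε (βᵢ)₅` has a
   maximum at `0`, so `ε (βᵢ''(0))₅ ≤ 0` (`EuclideanHypersurface.deriv2_nonneg_of_isLocalMin`).

Continuity of `u` and the time derivative come from the joint smoothness clause of `IsCylinderMCF`
(`hasDerivAt_slice` of `MCFComparisonPrinciple.lean`) and the flow equation `velocity_eq`.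

## References

* P. Topping, *Lectures on the Ricci flow*, LMS Lecture Note Series 325, CUP 2006, Thm. 3.1.1.
  [Topping2006]
* C. Mantegazza, *Lecture Notes on Mean Curvature Flow*, Progress in Mathematics 290, Birkhäuser 2011,
  §1.1 (the mean curvature vector) and §2.2 (comparison principles). [Mantegazza2011]
-/

-- the prescribed namespace `Summit.SmoothPoincare4.SmoothPoincare4.…` repeats `SmoothPoincare4`
set_option linter.dupNamespace false

noncomputable section

open Set
open scoped Manifold ContDiff RealInnerProductSpace Topology

namespace Summit.SmoothPoincare4.SmoothPoincare4.Cruxes.CylinderRungTwo.KillingFlux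

open Literature.Geometry.Riemannian
open Literature.Geometry.Lorentzian Literature.Geometry.Lorentzian.PseudoRiemannianMetric
open Literature.Geometry.Riemannian.EuclideanHypersurface
open Literature.Geometry.Manifold.CylinderSlice (axis castSucc_ne_five)

/-! ### Coordinates on `ℝ⁶` -/

/-- The inner product of `ℝ⁶` in coordinates: `⟪v, w⟫ = ∑ᵢ vᵢ wᵢ`. [folklore] -/
theorem inner_eq_sum_mul (v w : EuclideanSpace ℝ (Fin 6)) : ⟪v, w⟫ = ∑ i, v i * w i := by
  simp [PiLp.inner_apply, mul_comm]

/-- `⟪e₅, w⟫ = w₅`. [folklore] -/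
theorem inner_axis_left (w : EuclideanSpace ℝ (Fin 6)) : ⟪axis, w⟫ = w 5 := by
  rw [← heightL_apply, heightL_apply']

/-! ### A cross-section at a critical point of the height -/

section CriticalPoint

variable {M : Type*} [TopologicalSpace M] [ChartedSpace (EuclideanSpace ℝ (Fin 4)) M]
  [IsManifold (𝓡 4) ∞ M]

/-- **The radial normal of `N` is normal to a cross-section**: if `f : M → ℝ⁶` maps into
`N = {∑_{i<5} zᵢ² = 1}`, then `∑_{i<5} fᵢ(x) (df_x u)ᵢ = 0` for every tangent vector `u` (differentiate
the constant function `s ↦ ∑_{i<5} fᵢ(c s)²` along the chart-straight curve `c = curveThrough x u`,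
whose image under `f` has velocity `df_x u` at `s = 0`). [folklore] -/
theorem sum_mul_mfderiv_apply_eq_zero {f : M → EuclideanSpace ℝ (Fin 6)}
    (hf : ContMDiff (𝓡 4) (𝓡 6) ∞ f)
    (hcyl : ∀ y, ∑ i : Fin 5, f y (Fin.castSucc i) ^ 2 = 1) (x : M) (u : TangentSpace (𝓡 4) x) :
    ∑ i : Fin 5, f x (Fin.castSucc i) *
      WithLp.ofLp (mfderiv (𝓡 4) (𝓡 6) f x u) (Fin.castSucc i) = 0 := by
  set β := f ∘ curveThrough (𝓡 4) x u with hβ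
  have hd : HasDerivAt β (mfderiv (𝓡 4) (𝓡 6) f x u) 0 := hasDerivAt_comp_curveThrough_zero hf x u
  have hc : ∀ i : Fin 6, HasDerivAt (fun s => β s i)
      (WithLp.ofLp (mfderiv (𝓡 4) (𝓡 6) f x u) i) 0 := fun i =>
    (EuclideanSpace.proj i : EuclideanSpace ℝ (Fin 6) →L[ℝ] ℝ).hasFDerivAt.comp_hasDerivAt 0 hd
  have hsum : HasDerivAt (fun s => ∑ i : Fin 5, β s (Fin.castSucc i) ^ 2)
      (∑ i : Fin 5, ((2 : ℕ) : ℝ) * β 0 (Fin.castSucc i) ^ (2 - 1) *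
        WithLp.ofLp (mfderiv (𝓡 4) (𝓡 6) f x u) (Fin.castSucc i)) 0 :=
    HasDerivAt.fun_sum fun i _ => (hc (Fin.castSucc i)).pow 2
  have hconst : (fun s => ∑ i : Fin 5, β s (Fin.castSucc i) ^ 2) = fun _ => (1 : ℝ) := by
    funext s
    exact hcyl _
  rw [hconst] at hsum
  have h0 := (hasDerivAt_const (0 : ℝ) (1 : ℝ)).unique hsum
  simp only [hβ, Function.comp_apply, curveThrough_zero] at h0
  have h2 : ∑ i : Fin 5, f x (Fin.castSucc i) *
      WithLp.ofLp (mfderiv (𝓡 4) (𝓡 6) f x u) (Fin.castSucc i) =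
      (1 / 2) * ∑ i : Fin 5, ((2 : ℕ) : ℝ) * f x (Fin.castSucc i) ^ (2 - 1) *
        WithLp.ofLp (mfderiv (𝓡 4) (𝓡 6) f x u) (Fin.castSucc i) := by
    rw [Finset.mul_sum]
    refine Finset.sum_congr rfl fun i _ => ?_
    push_cast
    ring
  rw [h2, ← h0, mul_zero]

/-- **At a critical point of the height, `e₅ = ν₅ ν`.** Let `f : M → ℝ⁶` be an immersion of the
`4`-manifold `M` into `N`, `ν` a unit normal field along `f` tangent to `N` at `x`
(`∑_{i<5} νᵢ fᵢ = 0`), and suppose `(df_x u)₅ = 0` for all `u` (`x` is a critical point of `z₅ ∘ f`).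
Then `e₅ = ν₅(x) ν(x)`: the map `(v, c) ↦ df_x v + c n`, `n = (z', 0)` the radial unit normal of `N`
at `f x = (z', z₅)`, is injective from a `5`-dimensional space into `ℝ⁶` (`n ⊥ df`, `‖n‖ = 1`, `df_x`
injective), and both the unit vector `ν(x)` and `e₅` are orthogonal to its image, so `e₅` is a multiple
of `ν(x)` (`EuclideanHypersurface.eq_inner_smul_of_forall_inner_eq_zero`). [folklore] -/
theorem axis_eq_smul {f ν : M → EuclideanSpace ℝ (Fin 6)}
    (hf : (euclideanMetric (EuclideanSpace ℝ (Fin 6))).IsSpacelikeImmersion (𝓡 4) f)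
    (hν : (euclideanMetric (EuclideanSpace ℝ (Fin 6))).IsUnitNormal (𝓡 4) f ν 1)
    (hcyl : ∀ y, ∑ i : Fin 5, f y (Fin.castSucc i) ^ 2 = 1) {x : M}
    (htan : ∑ i : Fin 5, ν x (Fin.castSucc i) * f x (Fin.castSucc i) = 0)
    (hcrit : ∀ u : TangentSpace (𝓡 4) x, WithLp.ofLp (mfderiv (𝓡 4) (𝓡 6) f x u) 5 = 0) :
    axis = (ν x 5) • ν x := by
  set A : EuclideanSpace ℝ (Fin 4) →L[ℝ] EuclideanSpace ℝ (Fin 6) := mfderiv (𝓡 4) (𝓡 6) f x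
    with hA
  -- the radial normal `n = (z', 0)` of `N` at `f x = (z', z₅)`
  set n : EuclideanSpace ℝ (Fin 6) := f x - (f x 5) • axis with hn
  have hlast : (Fin.last 5 : Fin 6) = 5 := rfl
  have hn5 : n 5 = 0 := by simp [hn, axis]
  have hncs : ∀ i : Fin 5, n (Fin.castSucc i) = f x (Fin.castSucc i) := fun i => by
    simp [hn, axis, castSucc_ne_five]
  have hinner_n : ∀ v : EuclideanSpace ℝ (Fin 6),
      ⟪v, n⟫ = ∑ i : Fin 5, v (Fin.castSucc i) * f x (Fin.castSucc i) := by
    intro v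
    rw [inner_eq_sum_mul, Fin.sum_univ_castSucc]
    simp only [hlast, hn5, hncs, mul_zero, add_zero]
  have hAn : ∀ v, ⟪A v, n⟫ = 0 := fun v => by
    rw [hinner_n, ← sum_mul_mfderiv_apply_eq_zero hf.contMDiff_self hcyl x v]
    exact Finset.sum_congr rfl fun i _ => mul_comm _ _
  have hνn : ⟪ν x, n⟫ = 0 := by
    rw [hinner_n]
    exact htan
  have haxn : ⟪axis, n⟫ = 0 := by
    rw [hinner_n]
    simp [axis, castSucc_ne_five]
  have hnn : ⟪n, n⟫ = 1 := by
    rw [hinner_n]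
    simp only [hncs, ← sq]
    exact hcyl x
  have hAν : ∀ v, ⟪A v, ν x⟫ = 0 := fun v => by
    have h : ⟪ν x, A v⟫ = 0 := hν.isNormalTo x v
    rw [real_inner_comm]
    exact h
  have hAaxis : ∀ v, ⟪A v, axis⟫ = 0 := fun v => by
    rw [real_inner_comm, inner_axis_left]
    exact hcrit v
  have hνunit : ‖ν x‖ = 1 := by
    have h : ⟪ν x, ν x⟫ = (1 : ℝ) := hν.val_self x
    rw [real_inner_self_eq_norm_sq] at h
    rw [← Real.sqrt_sq (norm_nonneg (ν x)), h, Real.sqrt_one]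
  -- the injective codimension-one map `(v, c) ↦ df v + c n`
  set A' : (EuclideanSpace ℝ (Fin 4) × ℝ) →ₗ[ℝ] EuclideanSpace ℝ (Fin 6) :=
    A.toLinearMap.coprod (LinearMap.toSpanSingleton ℝ (EuclideanSpace ℝ (Fin 6)) n) with hA'
  have hA'apply : ∀ v, A' v = A v.1 + v.2 • n := fun v => rfl
  have hA'inj : Function.Injective A' := by
    refine (injective_iff_map_eq_zero _).2 fun v hv => ?_
    rw [hA'apply] at hv
    have h1 : v.2 = 0 := by
      have h := congrArg (fun w => ⟪w, n⟫) hv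
      simp only [inner_add_left, real_inner_smul_left, hAn, hnn, inner_zero_left] at h
      simpa using h
    have h2 : v.1 = 0 := by
      rw [h1, zero_smul, add_zero] at hv
      exact (injective_iff_map_eq_zero _).1 (hf.injective_mfderiv x) v.1 hv
    exact Prod.ext h2 h1
  have hdim : Module.finrank ℝ (EuclideanSpace ℝ (Fin 4) × ℝ) + 1 =
      Module.finrank ℝ (EuclideanSpace ℝ (Fin 6)) := by
    simp [Module.finrank_prod]
  have hνA' : ∀ v, ⟪A' v, ν x⟫ = 0 := fun v => by
    rw [hA'apply, inner_add_left, real_inner_smul_left, hAν, real_inner_comm, hνn]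
    ring
  have haxA' : ∀ v, ⟪A' v, axis⟫ = 0 := fun v => by
    rw [hA'apply, inner_add_left, real_inner_smul_left, hAaxis, real_inner_comm, haxn]
    ring
  have key := eq_inner_smul_of_forall_inner_eq_zero A' hA'inj hdim hνunit hνA' haxA'
  rwa [real_inner_comm, inner_axis_left] at key

/-- **`-H ν₅` at a critical point of the height is the height of the mean curvature vector**:
with `b` an `f^*δ`-orthonormal basis of `T_x M` and `βᵢ = f ∘ curveThrough x bᵢ`,
`-H(x) ν₅(x) = ∑ᵢ (βᵢ''(0))₅` — the tree's trace formula `H = -⟪ν, ∑ᵢ βᵢ''(0)⟫`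
(`EuclideanHypersurface.meanCurvature_eq_neg_inner_sum`, Mantegazza 2011, §1.1) together with
`e₅ = ν₅ ν` (`axis_eq_smul`). [cite: Mantegazza2011, §1.1] -/
theorem neg_meanCurvature_mul_eq_sum {f ν : M → EuclideanSpace ℝ (Fin 6)}
    (hf : (euclideanMetric (EuclideanSpace ℝ (Fin 6))).IsSpacelikeImmersion (𝓡 4) f)
    (hν : (euclideanMetric (EuclideanSpace ℝ (Fin 6))).IsUnitNormal (𝓡 4) f ν 1)
    (hνs : ContMDiff (𝓡 4) (𝓡 6) ∞ ν)
    (hcyl : ∀ y, ∑ i : Fin 5, f y (Fin.castSucc i) ^ 2 = 1) {x : M}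
    (htan : ∑ i : Fin 5, ν x (Fin.castSucc i) * f x (Fin.castSucc i) = 0)
    (hcrit : ∀ u : TangentSpace (𝓡 4) x, WithLp.ofLp (mfderiv (𝓡 4) (𝓡 6) f x u) 5 = 0)
    {ι : Type*} [Fintype ι] (b : Module.Basis ι ℝ (TangentSpace (𝓡 4) x))
    (hb : ((euclideanMetric (EuclideanSpace ℝ (Fin 6))).inducedMetric f contMDiff_pullbackBilin_holds
      hf).IsOrthonormalFrame x b) :
    -(euclideanMetric (EuclideanSpace ℝ (Fin 6))).meanCurvature f contMDiff_pullbackBilin_holds hf ν x *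
        ν x 5 = ∑ i, (deriv (deriv (f ∘ curveThrough (𝓡 4) x (b i))) 0) 5 := by
  rw [meanCurvature_eq_neg_inner_sum contMDiff_pullbackBilin_holds hf hνs hν.isNormalTo b hb, neg_neg]
  set S := ∑ i, deriv (deriv (f ∘ curveThrough (𝓡 4) x (b i))) 0 with hS
  have key : axis = (ν x 5) • ν x := axis_eq_smul hf hν hcyl htan hcrit
  calc ⟪ν x, S⟫ * ν x 5 = ⟪(ν x 5) • ν x, S⟫ := by rw [real_inner_smul_left, mul_comm]
    _ = S 5 := by rw [← key, inner_axis_left]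
    _ = ∑ i, (deriv (deriv (f ∘ curveThrough (𝓡 4) x (b i))) 0) 5 := by
      rw [hS, WithLp.ofLp_sum, Finset.sum_apply]

/-- **Second-order condition along a chart-straight curve.** If `x` maximises `y ↦ ε f(y)₅` over
`M`, then for `β = f ∘ curveThrough x u` the function `s ↦ ε (β s)₅` has a maximum at `s = 0`, so
`ε (β''(0))₅ ≤ 0` (one-variable second-derivative test
`EuclideanHypersurface.deriv2_nonneg_of_isLocalMin` applied to `-ε β₅`). [folklore] -/
theorem mul_deriv_deriv_apply_nonpos {f : M → EuclideanSpace ℝ (Fin 6)}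
    (hf : ContMDiff (𝓡 4) (𝓡 6) ∞ f) {x : M} {ε : ℝ} (hmax : IsMaxOn (fun y => ε * f y 5) univ x)
    (u : TangentSpace (𝓡 4) x) :
    ε * (deriv (deriv (f ∘ curveThrough (𝓡 4) x u)) 0) 5 ≤ 0 := by
  set β := f ∘ curveThrough (𝓡 4) x u with hβ
  have hsm : ∀ᶠ s in 𝓝 (0 : ℝ), ContDiffAt ℝ ∞ β s := eventually_contDiffAt_comp_curveThrough hf x u
  have hd : ∀ᶠ s in 𝓝 (0 : ℝ), HasDerivAt β (deriv β s) s :=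
    hsm.mono fun s hs => (hs.differentiableAt (by simp)).hasDerivAt
  have hdd : HasDerivAt (deriv β) (deriv (deriv β) 0) 0 :=
    hasDerivAt_deriv_of_contDiffAt hsm.self_of_nhds
  have hχ : ∀ᶠ s in 𝓝 (0 : ℝ), HasDerivAt (fun s => -(ε * β s 5)) (-(ε * deriv β s 5)) s :=
    hd.mono fun s hs =>
      (((EuclideanSpace.proj 5 : EuclideanSpace ℝ (Fin 6) →L[ℝ] ℝ).hasFDerivAt.comp_hasDerivAt s
        hs).const_mul ε).neg
  have hχ' : HasDerivAt (fun s => -(ε * deriv β s 5)) (-(ε * deriv (deriv β) 0 5)) 0 :=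
    (((EuclideanSpace.proj 5 : EuclideanSpace ℝ (Fin 6) →L[ℝ] ℝ).hasFDerivAt.comp_hasDerivAt 0
      hdd).const_mul ε).neg
  have hmin : IsLocalMin (fun s => -(ε * β s 5)) 0 :=
    Filter.Eventually.of_forall fun s => by
      have h : ε * f (curveThrough (𝓡 4) x u s) 5 ≤ ε * f x 5 := hmax (mem_univ _)
      simp only [hβ, Function.comp_apply, curveThrough_zero]
      linarith
  have key := deriv2_nonneg_of_isLocalMin hχ hχ' hmin
  linarith

/-- **The sign of `-H ν₅` at a spatial extremum of the height.** Let `f : M → ℝ⁶` be an immersion of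
the `4`-manifold `M` into `N = S⁴ × ℝ` with smooth unit normal field `ν` tangent to `N` at `x`, and let
`x` maximise `y ↦ ε f(y)₅` over `M` (`ε = 1`: a maximum of the height; `ε = -1`: a minimum). Then
`ε (-H(x) ν₅(x)) ≤ 0`, `H` the tree's mean curvature of `(f, ν)` (sign convention `∂ₜF = -H ν` is mean
curvature flow): the velocity of the flow points into the slab at the extrema of the height. Proof:
Fermat gives `(df_x u)₅ = 0`, so `-H ν₅ = ∑ᵢ (βᵢ''(0))₅` over an orthonormal frame
(`neg_meanCurvature_mul_eq_sum`), and each `ε (βᵢ''(0))₅ ≤ 0` (`mul_deriv_deriv_apply_nonpos`).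
[cite: Mantegazza2011, §1.1] -/
theorem mul_neg_meanCurvature_mul_nonpos {f ν : M → EuclideanSpace ℝ (Fin 6)}
    (hf : (euclideanMetric (EuclideanSpace ℝ (Fin 6))).IsSpacelikeImmersion (𝓡 4) f)
    (hν : (euclideanMetric (EuclideanSpace ℝ (Fin 6))).IsUnitNormal (𝓡 4) f ν 1)
    (hνs : ContMDiff (𝓡 4) (𝓡 6) ∞ ν)
    (hcyl : ∀ y, ∑ i : Fin 5, f y (Fin.castSucc i) ^ 2 = 1) {x : M}
    (htan : ∑ i : Fin 5, ν x (Fin.castSucc i) * f x (Fin.castSucc i) = 0) {ε : ℝ}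
    (hmax : IsMaxOn (fun y => ε * f y 5) univ x) :
    ε * (-(euclideanMetric (EuclideanSpace ℝ (Fin 6))).meanCurvature f contMDiff_pullbackBilin_holds
        hf ν x * ν x 5) ≤ 0 := by
  rcases eq_or_ne ε 0 with rfl | hε
  · rw [zero_mul]
  have hfs : ContMDiff (𝓡 4) (𝓡 6) ∞ f := hf.contMDiff_self
  -- `x` is a critical point of the height
  have hcrit : ∀ u : TangentSpace (𝓡 4) x, WithLp.ofLp (mfderiv (𝓡 4) (𝓡 6) f x u) 5 = 0 := by
    intro u
    have h5 : HasDerivAt (fun s => ε * (f ∘ curveThrough (𝓡 4) x u) s 5)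
        (ε * WithLp.ofLp (mfderiv (𝓡 4) (𝓡 6) f x u) 5) 0 :=
      ((EuclideanSpace.proj 5 : EuclideanSpace ℝ (Fin 6) →L[ℝ] ℝ).hasFDerivAt.comp_hasDerivAt 0
        (hasDerivAt_comp_curveThrough_zero hfs x u)).const_mul ε
    have hlm : IsLocalMax (fun s => ε * (f ∘ curveThrough (𝓡 4) x u) s 5) 0 :=
      Filter.Eventually.of_forall fun s => by
        have h : ε * f (curveThrough (𝓡 4) x u s) 5 ≤ ε * f x 5 := hmax (mem_univ _)
        simp only [Function.comp_apply, curveThrough_zero]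
        exact h
    exact (mul_eq_zero.1 (hlm.hasDerivAt_eq_zero h5)).resolve_left hε
  -- an orthonormal frame of `T_x M` for the induced metric
  set g' := (euclideanMetric (EuclideanSpace ℝ (Fin 6))).inducedMetric f contMDiff_pullbackBilin_holds hf
    with hg'
  have hpos : ∀ v : TangentSpace (𝓡 4) x, v ≠ 0 → 0 < g'.val x v v :=
    fun v hv => isRiemannian_inducedMetric _ _ contMDiff_pullbackBilin_holds hf x v hv
  obtain ⟨b, hb⟩ := g'.exists_basis_isOrthonormalFrame hpos
    (finrank_euclideanSpace_fin (𝕜 := ℝ) (n := 4))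
  rw [neg_meanCurvature_mul_eq_sum hf hν hνs hcyl htan hcrit b hb, Finset.mul_sum]
  exact Finset.sum_nonpos fun i _ => mul_deriv_deriv_apply_nonpos hfs hmax (b i)

end CriticalPoint

/-! ### The maximum principle for the height along the flow -/

section Flow

variable {M : Type} [TopologicalSpace M] [ChartedSpace (EuclideanSpace ℝ (Fin 4)) M]
  [IsManifold (𝓡 4) ∞ M] [CompactSpace M]

/-- **One-sided slab confinement.** For a cylinder flow `(F, ν)` on `[T, ∞)` (`IsCylinderMCF`), a sign
`ε` (meant: `±1`), `t ≥ T` and `x : M`, there is `y : M` with `ε (F t x)₅ ≤ ε (F T y)₅` (`y` a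
maximiser of `ε (F T ·)₅` on the compact `M`). This is the maximum principle at spatial maxima
(`le_zero_of_deriv_le_mul_at_isMaxOn`, Topping 2006, Thm. 3.1.1, with `C = 0`) for
`u(s, ·) = ε (F (T + s) ·)₅ - ε (F T y)₅` on the window `[0, t - T]`: `u` is continuous and has the
time derivative `ε (∂ₜF)₅ = ε (-H ν₅)` (joint smoothness, `hasDerivAt_slice`, flow equation
`velocity_eq`), which is `≤ 0` at every spatial maximum (`mul_neg_meanCurvature_mul_nonpos`).
[cite: Topping2006, Thm. 3.1.1] -/
theorem exists_mul_apply_five_le {F ν : ℝ → M → EuclideanSpace ℝ (Fin 6)} {T : ℝ}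
    (hF : IsCylinderMCF M F ν T) (ε : ℝ) {t : ℝ} (ht : T ≤ t) (x : M) :
    ∃ y : M, ε * F t x 5 ≤ ε * F T y 5 := by
  haveI : Nonempty M := ⟨x⟩
  obtain ⟨U, hU, hTU, hFU⟩ := hF.contMDiffOn
  have hcT : Continuous fun y => ε * F T y 5 :=
    continuous_const.mul ((EuclideanSpace.proj 5 : EuclideanSpace ℝ (Fin 6) →L[ℝ] ℝ).continuous.comp
      (hF.isSpacelikeImmersion T le_rfl).contMDiff_self.continuous)
  obtain ⟨y₀, -, hy₀⟩ := isCompact_univ.exists_isMaxOn univ_nonempty hcT.continuousOn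
  refine ⟨y₀, ?_⟩
  have hmemU : ∀ {s : ℝ}, 0 ≤ s → T + s ∈ U := fun hs => hTU (show T ≤ T + _ by linarith)
  set c : ℝ := ε * F T y₀ 5 with hc
  set u : ℝ → M → ℝ := fun s z => ε * F (T + s) z 5 - c with hu
  set u' : ℝ → M → ℝ := fun s z => ε * (deriv (fun r => F r z) (T + s)) 5 with hu'
  have hcont : ContinuousOn (fun p : M × ℝ => u p.2 p.1) (univ ×ˢ Icc 0 (t - T)) := by
    have h1 : ContinuousOn (fun p : M × ℝ => F (T + p.2) p.1) (univ ×ˢ Icc 0 (t - T)) :=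
      hFU.continuousOn.comp (f := fun p : M × ℝ => (T + p.2, p.1)) (by fun_prop)
        fun p hp => ⟨hmemU hp.2.1, mem_univ _⟩
    have h2 : ContinuousOn (fun p : M × ℝ => F (T + p.2) p.1 5) (univ ×ˢ Icc 0 (t - T)) :=
      (EuclideanSpace.proj 5 : EuclideanSpace ℝ (Fin 6) →L[ℝ] ℝ).continuous.comp_continuousOn h1
    exact (continuousOn_const.mul h2).sub continuousOn_const
  have hderiv : ∀ s ∈ Icc 0 (t - T), ∀ z,
      HasDerivWithinAt (fun s => u s z) (u' s z) (Icc 0 (t - T)) s := by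
    intro s hs z
    have h1 : HasDerivAt (fun r => F r z) (deriv (fun r => F r z) (T + s)) (T + s) :=
      hasDerivAt_slice hU hFU (hmemU hs.1) z
    have h2 : HasDerivAt (fun r => F (T + r) z) (deriv (fun r => F r z) (T + s)) s :=
      h1.comp_const_add T s
    have h3 := (((EuclideanSpace.proj 5 : EuclideanSpace ℝ (Fin 6) →L[ℝ] ℝ).hasFDerivAt.comp_hasDerivAt
      s h2).const_mul ε).sub_const c
    exact h3.hasDerivWithinAt
  have hmax : ∀ s ∈ Ioc 0 (t - T), ∀ z, IsMaxOn (u s) univ z → 0 < u s z → u' s z ≤ 0 * u s z := by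
    intro s hs z hz _
    have hTs : T ≤ T + s := by linarith [hs.1]
    have hz' : IsMaxOn (fun y => ε * F (T + s) y 5) univ z := fun y _ => by
      have h : u s y ≤ u s z := hz (mem_univ y)
      simp only [hu] at h
      show ε * F (T + s) y 5 ≤ ε * F (T + s) z 5
      linarith
    have key := mul_neg_meanCurvature_mul_nonpos (hF.isSpacelikeImmersion _ hTs)
      (hF.isUnitNormal _ hTs) (hF.contMDiff_normal _ hTs) (hF.mem_cyl _ hTs)
      (hF.normal_tangent _ hTs z) hz'
    have hvel : deriv (fun r => F r z) (T + s) =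
        -((euclideanMetric (EuclideanSpace ℝ (Fin 6))).meanCurvature (F (T + s))
          contMDiff_pullbackBilin_holds (hF.isSpacelikeImmersion _ hTs) (ν (T + s)) z) •
          ν (T + s) z := by
      rw [← mfderiv_slice_apply_one]
      exact hF.velocity_eq (T + s) hTs z
    show ε * (deriv (fun r => F r z) (T + s)) 5 ≤ 0 * u s z
    rw [zero_mul, hvel, PiLp.smul_apply, smul_eq_mul]
    exact key
  have hu0 : ∀ z, u 0 z ≤ 0 := fun z => by
    have h : ε * F T z 5 ≤ ε * F T y₀ 5 := hy₀ (mem_univ z)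
    simp only [hu, hc, add_zero]
    linarith
  have key := le_zero_of_deriv_le_mul_at_isMaxOn hcont hderiv 0 hmax hu0 (t - T)
    ⟨sub_nonneg.2 ht, le_rfl⟩ x
  simp only [hu, add_sub_cancel] at key
  linarith

end Flow

/-- **SLAB CONFINEMENT of a mean curvature flow of cross-sections in `N = S⁴ × ℝ`** (stub
`stub_slabConfinement`, 3b-ii, of line `killing-flux`, crux `CylinderEntropy.CylinderRungTwo`): along a
smooth mean curvature flow `(F, ν)` of closed embedded cross-sections of `N` on `[T, ∞)`
(`IsCylinderMCF`), the height `z₅` of every point of `Σ_t`, `t ≥ T`, lies between the minimal and the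
maximal initial heights: `∃ y y', (F T y)₅ ≤ (F t x)₅ ≤ (F T y')₅`. Both bounds are
`exists_mul_apply_five_le` with `ε = ∓1`: the maximum principle at spatial extrema of the height, where
`e₅ = ± ν`, `∂ₜ(F)₅ = -H ν₅`, and `-H ν₅ = ∑ᵢ (βᵢ'')₅` has the sign of the extremum.
[cite: Topping2006, Thm. 3.1.1] -/
theorem stub_slabConfinement :
    ∀ (M : Type) [TopologicalSpace M] [T2Space M] [SecondCountableTopology M]
      [ChartedSpace (EuclideanSpace ℝ (Fin 4)) M] [IsManifold (𝓡 4) ∞ M] [CompactSpace M]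
      (F : ℝ → M → EuclideanSpace ℝ (Fin 6)) (ν : ℝ → M → EuclideanSpace ℝ (Fin 6)) (T : ℝ),
      IsCylinderMCF M F ν T → ∀ t, T ≤ t → ∀ x : M, ∃ y y' : M, F T y 5 ≤ F t x 5 ∧ F t x 5 ≤ F T y' 5 := by
  intro M _ _ _ _ _ _ F ν T hF t ht x
  obtain ⟨y', hy'⟩ := exists_mul_apply_five_le hF 1 ht x
  obtain ⟨y, hy⟩ := exists_mul_apply_five_le hF (-1) ht x
  exact ⟨y, y', by linarith, by linarith⟩

end Summit.SmoothPoincare4.SmoothPoincare4.Cruxes.CylinderRungTwo.KillingFlux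

end
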